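import Literature.MathematicalPhysics.QuantumFieldTheory.Balaban1983to89.B6Ineq268MultiLevelBoxL0
import Literature.MathematicalPhysics.QuantumFieldTheory.Balaban1983to89.B6QGQCoerciveTowerTorus
import Literature.MathematicalPhysics.QuantumFieldTheory.Balaban1983to89.B6Geom246MultiLevelBoxL0
import Literature.MathematicalPhysics.QuantumFieldTheory.Balaban1983to89.B6MultiLevelBoxOperatorL0
import Literature.MathematicalPhysics.QuantumFieldTheory.Balaban1983to89.B6QGQCoerciveMultiLevelBox

/-!
# `Balaban1983to89.B6QGQCoerciveMultiLevelBoxL0` — LEVEL-0 TWIN (programme G-F3′-L0, director-ym LINE №27 / UV3-NODE §24.5; plan `lit-balaban-r03/G-F3L0-PLAN.md`) of `B6QGQCoerciveMultiLevelBox`: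
the same declarations, SAME NAMES AND STATEMENTS, for nested families WITH print's region `Λ₀ = T ∖ Ω₁` ADMITTED (structures
`B6MultiLevelBoxOperatorL0.Domains` / `B6MultiLevelTorusOperatorL0.TDomains`: levels `0, …, k`, the level-`0` block a single site, `Q′₀ = id`,
finite weight `a₀` — print p.225 (2.14) «Σ_{j=0}^k … (Q′₀λ)(x) = λ(x), x ∈ Λ₀», p.229 «taking a sequence (2.1) … smallest possible domains B^j(Λ_j),
and considering the operator Δ_a defined by (2.19), (2.20) for this sequence»).  Every `D`-free object is the lineage's, consumed BY NAME; no existing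
module is touched; no fact is minted.  Unit `lit-balaban-r03` (B6 fold owner, r03 gen 36); referee ref-4.  THE TWIN'S DOCUMENTATION FOLLOWS
VERBATIM (its «levels 1 … k» / «Ω₁ = X» sentences describe the twin; here `j` runs from `0` and `Ω₁` may be a proper subset).

# `Balaban1983to89.B6QGQCoerciveMultiLevelBox` — [B6] (2.74)–(2.78) FOR THE GENUINE `k`-LEVEL OPERATOR ON A BOX:
the LEVEL-WEIGHTED coercivity of `Q′G′Q′*` and of `Q′G′²Q′*` for `G′ = Δ′_a⁻¹` of an ARBITRARY nested family (2.1)–(2.2)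
on a Neumann box — `⟨ω, Q′G′Q′*ω⟩ ≥ γ·Σ_y(L^jη)^{d}(L^jη)²ω(y)²` and, on two adjacent levels,
`⟨ω, Q′G′²Q′*ω⟩ ≥ γ′·Σ_y(L^jη)^{d}(L^jη)⁴ω(y)²` — uniformly in `k` and in the family (file 2 of the `k`-level
Proposition 2.3 programme of seat p21; no existing module is touched; no fact is minted)

FRAMING (verbatim cell line):
statement-level skeleton of published theorems with citation tags; proofs where landed; nothing here is a claim about the Yang–Mills mass gap

Source under audit (cell pub-balaban / lit-balaban): T. Bałaban, *Propagators and renormalization transformations for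
lattice gauge theories. II*, Commun. Math. Phys. **96** (1984) 223–250 [`Balaban1984PropagatorsII`, "B6"], pp. 235–236
[PDF 13–14] (2.70)–(2.78) (held text `paper:balaban1984-cmp96-propagators-rt-ii` p0013–p0014, read this generation);
T. Bałaban, *… I*, Commun. Math. Phys. **95** (1984) 17–40 [`Balaban1984PropagatorsI`, "[4]"], p. 25 (the positivity of
`Q′G′Q′*`).  Unit `lit-balaban-p21` (Phase-2 proof seat p21 gen 13), HOME `run/shared/lean/pub/lit-balaban/`, free-target
protocol G.5-34(d), B6 fold owner r03, referee ref-4.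

## WHAT IS PRINTED (pp. 235–236, verbatim up to notation)

«At first let us find bounds on C_□. We assume that either □̃ ⊂ B^j(Λ_j), or it intersects B^{j+1}(Λ_{j+1}) also. We have
for ω defined on 𝔅 ∩ □ … ⟨ω, (Q′G′(□̃)²Q′*)↾□ ω⟩ = … (2.71) … = ‖G′^ξ_j(□̃)Q′_j*ω₁‖² (2.72) … ≥ Σ_Δ|⟨χ_Δ, G′^ξ_j(□̃)Q′*_jω₁⟩|²
(2.73) … ⟨ω₁, Q′_jG′_j(□̃)Q′_j*ω₁⟩ ≥ … (2.74) … Q′_jG′_jQ′_j* ≥ 2γ₀, (2.76) where γ₀ is an absolute constant (a = 1) …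
⟨ω₁, Q′_jG′_j(□̃)Q′_j*ω₁⟩ ≥ γ₀‖ω₁‖² (2.77) … ⟨ω, (Q′G′^ξ(□̃)²Q′*)ω⟩ ≥ γ₀²‖ω‖². (2.78)»

## WHAT THIS FILE CERTIFIES (kernel-checked; setting of `B6MultiLevelBoxOperator` / `B6Ineq268MultiLevelBox`)

For every nested family `D : Domains d ℓ M_h k P R` on the fine box (lattice units, spatial dimension `d + 1`), every
positive weight sequence with `a_j ≤ a₊` (`j ≥ 1`), the genuine `k`-level `Δ′_a = mlOp` and `G′ = gml = Δ′_a⁻¹`: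
* §1 block charts: the sites of the block `B^j(y)` ARE the chart points `L^j·y + t`, `t ∈ [0, L^j)^{d+1}` (`siteOf`,
  `sum_fiber_eq_sum_chart`), so `#B^j(y) = L^{j(d+1)} = W(y)` exactly (`card_blkOf_eq`) and `|Q′*ω|² = Σ_y W(y)ω(y)²`
  (`QsB_dot_QsB`);
* §2 the block bump `b(x) = Π_μ β̃(x_μ mod L^j)` of p01's profile `β̃` (`B6QGQCoerciveTowerTorus.bumpN`): block sum `W(y)`
  (`sum_bump_fiber`), `0 ≤ b ≤ (3/2)^{d+1}`, `≤ (6/L^j)(3/2)^d` on the faces of the block, `(6/L^j)(3/2)^d`-Lipschitz inside it;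
  the test field `v = Σ_y (L^j)²ω(y)·b·1_{B^j(y)}` (`testV`) with `⟨v, Q′*ω⟩ = S(ω) := Σ_y W(y)(L^j)²ω(y)²` (`testV_dot_QsB`);
* §3 **the energy bound** `⟨v, Δ′_av⟩ ≤ C_E·S(ω)`, `C_E = 2(d+1)·72(9/4)^d + a₊` (`energy_le`): the bond form is `O(1)`
  per block because the bump is flat inside and `O(1/L^j)` at the faces, the averaging form is `Σ_j a_j(L^j)^{−2}‖Q′_jv‖²
  = Σ_y a_jW(L^j)²ω²` exactly (`avgForm_eq`);
* §4 **(2.74)–(2.77), LEVEL-WEIGHTED, FOR THE GENUINE `k`-LEVEL OPERATOR** (`qgq_coercive_multiLevelBox`):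
  `⟨Q′*ω, G′Q′*ω⟩ ≥ γ·Σ_y W(y)(L^j)²ω(y)²`, `γ = 1/C_E`, by the variational principle
  `⟨u, Δ⁻¹u⟩ ≥ 2⟨A, u⟩ − ⟨A, ΔA⟩` (`QGQInverse.two_dot_sub_form_le_inv_form`) with `A = v/C_E`; and **(2.78)**
  (`qggq_lower_multiLevelBox`, `qggq_coercive_window`): `‖G′Q′*ω‖²·Σ_yWω² ≥ (γS(ω))²` (Cauchy–Schwarz), hence for `ω`
  carried by two adjacent levels `j₀, j₀ + 1` — print's «either □̃ ⊂ B^j(Λ_j), or it intersects B^{j+1}(Λ_{j+1}) also» —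
  `⟨ω, Q′G′²Q′*ω⟩ = ‖G′Q′*ω‖² ≥ (γ²/L²)·Σ_y W(y)(L^j)⁴ω(y)²`.  All constants depend on `d`, `L`, `a₊` only: uniform in
  `k`, `M_h`, `R`, `P` and in the family — the input «Q′G′²Q′* ≥ γ₀²» ((2.78), [3] (5.6)) of the cube inverses (2.79)–(2.81).

## HONEST SCOPE

* The printed route to (2.76) is the Fourier representation (2.75) of the ONE-level `Q′_jG′_jQ′_j*` on `L^{−j}ℤ^d` plus
  [4] (2.50)–(2.51) (tree: `B6QGQFourier275Zd`, scalar, whole lattice); THIS FILE proves the level-weighted lower bound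
  DIRECTLY for the genuine `k`-level box operator by the variational principle with block bumps (the route of the cell's
  written repair `QGQInverse` §5 and of p01's one-scale `B6QGQCoerciveTowerTorus`), which needs no restriction to one
  level and no Fourier analysis; the level weights `(L^jη)²`, `(L^jη)⁴` are print's rescaling to the `ξ = L^{−j}` lattice
  ((2.71), (2.80)) written in `η`-units.
* Neumann box, levels `1 … k`, `A = 0`, lattice units — the scope of the `k`-level chain; constants not optimised.
* Nothing is inferred from the manuscript: every step is kernel-checked; the quoted sentences locate the statements.
-/

namespace Literature.MathematicalPhysics.QuantumFieldTheory.Balaban1983to89.B6QGQCoerciveMultiLevelBoxL0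

open Finset Matrix
open Literature.MathematicalPhysics.QuantumFieldTheory.Balaban1983to89.B4Reflection242 (boxDom mem_boxDom blk nbrs
  mem_nbrs card_nbrs neumannLapK avgK diagK)
open Literature.MathematicalPhysics.QuantumFieldTheory.Balaban1983to89.B4Green242Bridge (boxNbrs mem_boxNbrs_comm
  card_boxNbrs)
open Literature.MathematicalPhysics.QuantumFieldTheory.Balaban1983to89.B4Green244 (finePt)
open Literature.MathematicalPhysics.QuantumFieldTheory.Balaban1983to89.B4BoxCov237 (opBoxR quadFormR_eq finePt_apply
  blk_finePt finePt_injective)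
open Literature.MathematicalPhysics.QuantumFieldTheory.Balaban1983to89.B6MultiLevelBoxOperator hiding Domains mlOp_apply
open Literature.MathematicalPhysics.QuantumFieldTheory.Balaban1983to89.B6MultiLevelBoxOperatorL0
open Literature.MathematicalPhysics.QuantumFieldTheory.Balaban1983to89.B6Geom246MultiLevelBox hiding Touch blkOf blkOf_corner blkOf_eq_iff_blk blkOf_eq_of_blk_i_eq blkOf_val bond bond_adj bset cen connected coord_bounds corner corner_mem csys dist_blkOf_le_box dist_blkOf_le_coord dist_blkOf_le_line dist_cen_le_of_adj dist_cen_le_of_touch dist_le_one_of_near dist_toR_cen_le exists_blkOf_eq geom lemma21_box lev_corner lev_eq_of_blkOf_eq levelGap pack reachable_blkOf reachable_of_near realizes scale_bounds touch_symm triangle_refl_nonneg walk_disp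
open Literature.MathematicalPhysics.QuantumFieldTheory.Balaban1983to89.B6Geom246MultiLevelBoxL0
open Literature.MathematicalPhysics.QuantumFieldTheory.Balaban1983to89.B6Ineq268MultiLevelBox hiding QB QB_apply QsB QsB_apply W W_eq W_pos Xk abs_qB abs_qB_le card_blkOf_le csysB geomB geomB_L geomB_M geomB_R geomB_RM geomB_RM_nonneg geomB_Site geomB_dist geomB_eta geomB_len geom_len ineq268_multiLevelBox instDecidableEqGeomBSite kerOp_Xk levelSepB qB qB_ne_zero realizesB refl_nonnegB sum_abs_qB_le symmB triangleB
open Literature.MathematicalPhysics.QuantumFieldTheory.Balaban1983to89.B6Ineq268MultiLevelBoxL0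
open Literature.MathematicalPhysics.QuantumFieldTheory.Balaban1983to89.B6QGQCoerciveTowerTorus (bumpN sum_bumpN
  bumpN_nonneg bumpN_le bumpN_zero_le bumpN_last_le abs_bumpN_succ_sub_le)
open Literature.MathematicalPhysics.QuantumFieldTheory.Balaban1983to89.QGQInverse (two_dot_sub_form_le_inv_form)
open Literature.MathematicalPhysics.QuantumFieldTheory.Balaban1983to89.B6QGQCoerciveMultiLevelBox (offN c1 CE CE_pos one_le_N0)

noncomputable section

variable {d : ℕ}

/-! ## §1 Block charts: the sites of `B^j(y)` are `L^j·y + t`, `t ∈ [0, L^j)^{d+1}` -/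

section Charts

variable {ℓ Mh k R : ℕ} {P : Fin (d + 1) → ℕ} (D : Domains d ℓ Mh k P R)

/-- `n(y) = L^j`, the side of the block `B^j(y)` in fine sites. [cite: Balaban1984PropagatorsII, (2.1) p.224 («T^{(j)}_{L^jη}»), dictionary] -/
def nb (s : ↥(bset D)) : ℕ := (ℓ + 1) ^ s.1.1

/-- `n(y) ≥ 1`. [cite: Balaban1984PropagatorsII, (2.1) p.224, dictionary] -/
theorem one_le_nb (s : ↥(bset D)) : 1 ≤ nb D s := Nat.one_le_pow _ _ (by omega)

/-- `n(y) = L^jη = len(y)` as a real (lattice units). [cite: Balaban1984PropagatorsII, (2.1) p.224, dictionary] -/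
theorem nb_cast (s : ↥(bset D)) : ((nb D s : ℕ) : ℝ) = (geom D).len s := by
  rw [geom_len, mul_one]; unfold nb; push_cast; ring

/-- `W(y) = n(y)^{d+1}`. [cite: Balaban1984PropagatorsII, (2.69) p.235, dictionary] -/
theorem W_eq_nb_pow (s : ↥(bset D)) : W D s = ((nb D s : ℕ) : ℝ) ^ (d + 1) := by
  rw [W_eq]; unfold nb; push_cast; ring

/-- `x_μ mod n < n`. [folklore] -/
private theorem offN_lt {n : ℕ} (hn : 1 ≤ n) (z : Fin (d + 1) → ℤ) (μ : Fin (d + 1)) : offN n z μ < n := by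
  unfold offN
  have h0 : (0 : ℤ) ≤ z μ % (n : ℤ) := Int.emod_nonneg _ (by exact_mod_cast (by omega : n ≠ 0))
  have h1 : z μ % (n : ℤ) < n := Int.emod_lt_of_pos _ (by exact_mod_cast hn)
  exact (Int.toNat_lt h0).2 h1

/-- `x_μ = n·⌊x_μ/n⌋ + (x_μ mod n)`. [folklore] -/
private theorem coord_eq_blk_add_offN {n : ℕ} (hn : 1 ≤ n) (z : Fin (d + 1) → ℤ) (μ : Fin (d + 1)) :
    z μ = (n : ℤ) * blk n z μ + (offN n z μ : ℤ) := by
  unfold offN blk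
  have h0 : (0 : ℤ) ≤ z μ % (n : ℤ) := Int.emod_nonneg _ (by exact_mod_cast (by omega : n ≠ 0))
  rw [Int.toNat_of_nonneg h0]
  exact (Int.mul_ediv_add_emod _ _).symm

/-- the offset of a chart point is its chart coordinate. [folklore] -/
private theorem offN_finePt {n : ℕ} (hn : 1 ≤ n) (y : Fin (d + 1) → ℤ) (t : Fin (d + 1) → Fin n) (μ : Fin (d + 1)) :
    offN n (finePt n y t) μ = t μ := by
  have h := coord_eq_blk_add_offN hn (finePt n y t) μ
  rw [blk_finePt hn, finePt_apply] at h
  exact_mod_cast (add_left_cancel h).symm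

/-- the block `B^j(y)` fits inside the box: `L^j·y_μ + L^j ≤ N_μ` (the box side is a multiple of `L^j`, `j ≤ k`).
[cite: Balaban1984PropagatorsII, (2.1) p.224, dictionary] -/
theorem block_fits (s : ↥(bset D)) (μ : Fin (d + 1)) :
    (0 : ℤ) ≤ (nb D s : ℤ) * s.1.2 μ ∧ (nb D s : ℤ) * s.1.2 μ + nb D s ≤ (N0 ℓ Mh k P μ : ℤ) := by
  have hc := (mem_boxDom.1 (corner_mem D s)) μ
  change 0 ≤ (((ℓ + 1) ^ s.1.1 : ℕ) : ℤ) * s.1.2 μ ∧ (((ℓ + 1) ^ s.1.1 : ℕ) : ℤ) * s.1.2 μ < (N0 ℓ Mh k P μ : ℤ) at hc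
  refine ⟨by unfold nb; exact hc.1, ?_⟩
  have hjk : s.1.1 ≤ k := (scale_bounds D s).2
  have hdvd : ((nb D s : ℕ) : ℤ) ∣ (N0 ℓ Mh k P μ : ℤ) := by
    refine Int.natCast_dvd_natCast.2 ⟨(ℓ + 1) ^ (k - s.1.1) * ((ℓ + 1) * (Mh * P μ)), ?_⟩
    unfold nb N0
    rw [← mul_assoc ((ℓ + 1) ^ s.1.1), pow_mul_pow_sub _ hjk]
  obtain ⟨q, hq⟩ := hdvd
  have hn : (0 : ℤ) < (nb D s : ℤ) := by exact_mod_cast one_le_nb D s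
  have hlt : ((nb D s : ℕ) : ℤ) * s.1.2 μ < ((nb D s : ℕ) : ℤ) * q := by rw [← hq]; unfold nb; exact hc.2
  have hlt' : s.1.2 μ < q := lt_of_mul_lt_mul_left hlt hn.le
  rw [hq]; nlinarith

/-- **the chart of the block**: `t ↦ L^j·y + t`, a site of the box. [cite: Balaban1984PropagatorsII, (2.1) p.224, dictionary] -/
def siteOf (s : ↥(bset D)) (t : Fin (d + 1) → Fin (nb D s)) : ↥(boxDom (N0 ℓ Mh k P)) :=
  ⟨finePt (nb D s) s.1.2 t, by
    rw [mem_boxDom]; intro μ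
    have hb := block_fits D s μ
    have ht : ((t μ : ℕ) : ℤ) < nb D s := by exact_mod_cast (t μ).isLt
    rw [finePt_apply]
    constructor <;> omega⟩

/-- coordinates of the chart point. [folklore] -/
@[simp] private theorem siteOf_val (s : ↥(bset D)) (t : Fin (d + 1) → Fin (nb D s)) :
    (siteOf D s t).1 = finePt (nb D s) s.1.2 t := rfl

/-- the chart point lies in the block. [cite: Balaban1984PropagatorsII, (2.1) p.224, dictionary] -/
theorem blkOf_siteOf (s : ↥(bset D)) (t : Fin (d + 1) → Fin (nb D s)) : blkOf D (siteOf D s t) = s :=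
  (blkOf_eq_iff_blk D).2 (by rw [siteOf_val]; exact blk_finePt (one_le_nb D s) _ _)

/-- the chart is injective. [folklore] -/
private theorem siteOf_injective (s : ↥(bset D)) : Function.Injective (siteOf D s) := fun _ _ h =>
  finePt_injective _ _ (congrArg Subtype.val h)

/-- the offset of a site of `B^j(y)`, as a chart coordinate. [folklore] -/
def offOf (s : ↥(bset D)) (x : ↥(boxDom (N0 ℓ Mh k P))) : Fin (d + 1) → Fin (nb D s) :=
  fun μ => ⟨offN (nb D s) x.1 μ, offN_lt (one_le_nb D s) _ _⟩

/-- every site of `B^j(y)` is a chart point (at its offset). [cite: Balaban1984PropagatorsII, (2.1) p.224, dictionary] -/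
theorem siteOf_offOf {s : ↥(bset D)} {x : ↥(boxDom (N0 ℓ Mh k P))} (hx : blkOf D x = s) :
    siteOf D s (offOf D s x) = x := by
  apply Subtype.ext
  rw [siteOf_val]
  funext μ
  rw [finePt_apply]
  have h := coord_eq_blk_add_offN (one_le_nb D s) x.1 μ
  have hb : blk (nb D s) x.1 = s.1.2 := (blkOf_eq_iff_blk D).1 hx
  rw [hb] at h
  rw [h]; rfl

/-- **THE BLOCK IS THE IMAGE OF ITS CHART**. [cite: Balaban1984PropagatorsII, (2.1) p.224, dictionary] -/
theorem filter_blkOf_eq_image (s : ↥(bset D)) :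
    (Finset.univ.filter fun x : ↥(boxDom (N0 ℓ Mh k P)) => blkOf D x = s) = Finset.univ.image (siteOf D s) := by
  classical
  ext x
  simp only [Finset.mem_filter, Finset.mem_univ, true_and, Finset.mem_image]
  constructor
  · intro h; exact ⟨offOf D s x, siteOf_offOf D h⟩
  · rintro ⟨t, rfl⟩; exact blkOf_siteOf D s t

/-- **sums over a block are sums over the chart**. [cite: Balaban1984PropagatorsII, (2.1) p.224, dictionary] -/
theorem sum_fiber_eq_sum_chart (s : ↥(bset D)) (F : ↥(boxDom (N0 ℓ Mh k P)) → ℝ) :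
    ∑ x ∈ Finset.univ.filter (fun x => blkOf D x = s), F x = ∑ t : Fin (d + 1) → Fin (nb D s), F (siteOf D s t) := by
  classical
  rw [filter_blkOf_eq_image, Finset.sum_image fun _ _ _ _ h => siteOf_injective D s h]

/-- **`#B^j(y) = L^{j(d+1)} = W(y)`** exactly. [cite: Balaban1984PropagatorsII, (2.1) p.224, (2.69) p.235, dictionary] -/
theorem card_blkOf_eq (s : ↥(B6Geom246MultiLevelBoxL0.bset D)) :
    (((Finset.univ.filter fun x : ↥(boxDom (N0 ℓ Mh k P)) => blkOf D x = s).card : ℕ) : ℝ) = W D s := by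
  classical
  rw [filter_blkOf_eq_image, Finset.card_image_of_injective _ (siteOf_injective D s), Finset.card_univ,
    Fintype.card_fun, Fintype.card_fin, Fintype.card_fin, W_eq_nb_pow]
  push_cast; ring

/-- sums of a block function over the fine box: `Σ_x F(y(x)) = Σ_y W(y)F(y)`. [cite: Balaban1984PropagatorsII, (2.69) p.235, dictionary] -/
theorem sum_blockFun (F : ↥(B6Geom246MultiLevelBoxL0.bset D) → ℝ) :
    ∑ x : ↥(boxDom (N0 ℓ Mh k P)), F (blkOf D x) = ∑ s, W D s * F s := by
  classical
  rw [← Finset.sum_fiberwise Finset.univ (blkOf D) fun x => F (blkOf D x)]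
  refine Finset.sum_congr rfl fun s _ => ?_
  rw [Finset.sum_congr rfl fun x hx => by rw [(Finset.mem_filter.1 hx).2], Finset.sum_const, nsmul_eq_mul,
    card_blkOf_eq]

/-- **`|Q′*ω|² = Σ_y W(y)ω(y)² = ‖ω‖²_{(2.69)}`** (`Q′*` is an isometry from `L²(𝔅)` with the pairing (2.69) into the fine `L²`).
[cite: Balaban1984PropagatorsII, (2.69) p.235, (2.72) p.236] -/
theorem QsB_dot_QsB (ω : ↥(B6Geom246MultiLevelBoxL0.bset D) → ℝ) : QsB D ω ⬝ᵥ QsB D ω = ∑ s, W D s * ω s ^ 2 := by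
  unfold dotProduct
  simp only [QsB_apply, ← sq]
  exact sum_blockFun D fun s => ω s ^ 2

/-- same `j`-grid block ⟺ same block of `𝔅` (for the grid of the level of `x`). [cite: Balaban1984PropagatorsII, (2.1) p.224] -/
theorem blk_eq_iff_blkOf_eq (x y : ↥(boxDom (N0 ℓ Mh k P))) :
    blk (nb D (blkOf D x)) y.1 = blk (nb D (blkOf D x)) x.1 ↔ blkOf D y = blkOf D x := by
  have hx : blk (nb D (blkOf D x)) x.1 = (blkOf D x).1.2 := rfl
  rw [hx]
  exact (blkOf_eq_iff_blk D).symm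

end Charts

/-! ## §2 The block bump and the test field -/

section Bump

variable {ℓ Mh k R : ℕ} {P : Fin (d + 1) → ℕ} (D : Domains d ℓ Mh k P R)

/-- **the block bump** `b(x) = Π_μ β̃_{L^j}(x_μ mod L^j)`, `x ∈ B^j(y)`: p01's normalised profile in each coordinate of
the block of `x`. [cite: Balaban1984PropagatorsI, p.25 (positivity of Q′G′Q′*); Balaban1984PropagatorsII, (2.74)–(2.77) p.236; bookkeeping] -/
def bump (x : ↥(boxDom (N0 ℓ Mh k P))) : ℝ :=
  ∏ μ, bumpN (nb D (blkOf D x)) (offN (nb D (blkOf D x)) x.1 μ)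

/-- `b ≥ 0`. [cite: Balaban1984PropagatorsI, p.25; bookkeeping] -/
theorem bump_nonneg (x : ↥(boxDom (N0 ℓ Mh k P))) : 0 ≤ bump D x :=
  Finset.prod_nonneg fun _ _ => bumpN_nonneg (one_le_nb D _) (offN_lt (one_le_nb D _) _ _)

/-- a product of `m` profile values lies in `[0, (3/2)^m]`. [folklore] -/
private theorem prod_bumpN_le {n : ℕ} (hn : 1 ≤ n) (T : Finset (Fin (d + 1))) (r : Fin (d + 1) → ℕ) (hr : ∀ μ, r μ < n) :
    0 ≤ ∏ μ ∈ T, bumpN n (r μ) ∧ ∏ μ ∈ T, bumpN n (r μ) ≤ (3 / 2 : ℝ) ^ T.card := by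
  refine ⟨Finset.prod_nonneg fun μ _ => bumpN_nonneg hn (hr μ), ?_⟩
  calc ∏ μ ∈ T, bumpN n (r μ) ≤ ∏ _μ ∈ T, (3 / 2 : ℝ) :=
        Finset.prod_le_prod (fun μ _ => bumpN_nonneg hn (hr μ)) fun μ _ => bumpN_le hn _
    _ = (3 / 2 : ℝ) ^ T.card := Finset.prod_const _

/-- `b ≤ (3/2)^{d+1}`. [cite: Balaban1984PropagatorsI, p.25; bookkeeping] -/
theorem bump_le (x : ↥(boxDom (N0 ℓ Mh k P))) : bump D x ≤ (3 / 2 : ℝ) ^ (d + 1) := by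
  have h := (prod_bumpN_le (one_le_nb D (blkOf D x)) Finset.univ (fun μ => offN (nb D (blkOf D x)) x.1 μ)
    fun μ => offN_lt (one_le_nb D _) _ _).2
  rwa [Finset.card_univ, Fintype.card_fin] at h

/-- **the bump is small on the faces of its block**: if `x_μ mod L^j ∈ {0, L^j − 1}` for some `μ` then
`b(x) ≤ (6/L^j)·(3/2)^d`. [cite: Balaban1984PropagatorsI, p.25; bookkeeping] -/
theorem bump_face_le (x : ↥(boxDom (N0 ℓ Mh k P))) (μ : Fin (d + 1))
    (h : offN (nb D (blkOf D x)) x.1 μ = 0 ∨ offN (nb D (blkOf D x)) x.1 μ + 1 = nb D (blkOf D x)) :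
    bump D x ≤ 6 / ((nb D (blkOf D x) : ℕ) : ℝ) * (3 / 2 : ℝ) ^ d := by
  set n := nb D (blkOf D x) with hn
  have hn1 : 1 ≤ n := one_le_nb D _
  unfold bump
  rw [← hn, ← Finset.mul_prod_erase Finset.univ _ (Finset.mem_univ μ)]
  have hP := prod_bumpN_le hn1 (Finset.univ.erase μ) (fun ν => offN n x.1 ν) fun ν => offN_lt hn1 _ _
  rw [Finset.card_erase_of_mem (Finset.mem_univ μ), Finset.card_univ, Fintype.card_fin, Nat.add_sub_cancel] at hP
  have hsmall : bumpN n (offN n x.1 μ) ≤ 6 / n := by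
    rcases h with h | h
    · rw [h]; exact bumpN_zero_le hn1
    · have : offN n x.1 μ = n - 1 := by omega
      rw [this]; exact bumpN_last_le hn1
  have h6 : (0 : ℝ) ≤ 6 / n := by positivity
  calc bumpN n (offN n x.1 μ) * ∏ ν ∈ Finset.univ.erase μ, bumpN n (offN n x.1 ν)
      ≤ 6 / n * ∏ ν ∈ Finset.univ.erase μ, bumpN n (offN n x.1 ν) := mul_le_mul_of_nonneg_right hsmall hP.1
    _ ≤ 6 / n * (3 / 2 : ℝ) ^ d := mul_le_mul_of_nonneg_left hP.2 h6

/-- **the bump is `(6/L^j)(3/2)^d`-Lipschitz along bonds inside its block**: for `x′ = x + e_μ` in the same block,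
`|b(x′) − b(x)| ≤ (6/L^j)(3/2)^d`. [cite: Balaban1984PropagatorsI, p.25; bookkeeping] -/
theorem abs_bump_sub_le {x x' : ↥(boxDom (N0 ℓ Mh k P))} (hs : blkOf D x' = blkOf D x) {μ : Fin (d + 1)}
    (hx' : x'.1 = x.1 + Pi.single μ 1) :
    |bump D x' - bump D x| ≤ 6 / ((nb D (blkOf D x) : ℕ) : ℝ) * (3 / 2 : ℝ) ^ d := by
  set n := nb D (blkOf D x) with hn
  have hn1 : 1 ≤ n := one_le_nb D _
  -- offsets: equal off `μ`, shifted by one at `μ`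
  have hblk : blk n x'.1 = blk n x.1 := (blk_eq_iff_blkOf_eq D x x').2 hs
  have hoff : ∀ ν, (offN n x'.1 ν : ℤ) = offN n x.1 ν + (if ν = μ then 1 else 0) := by
    intro ν
    have h1 := coord_eq_blk_add_offN hn1 x.1 ν
    have h2 := coord_eq_blk_add_offN hn1 x'.1 ν
    rw [hblk] at h2
    have hval : x'.1 ν = x.1 ν + (if ν = μ then 1 else 0) := by
      rw [hx', Pi.add_apply, Pi.single_apply]
    linarith
  have hoffμ : offN n x'.1 μ = offN n x.1 μ + 1 := by have := hoff μ; rw [if_pos rfl] at this; exact_mod_cast this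
  have hoffν : ∀ ν, ν ≠ μ → offN n x'.1 ν = offN n x.1 ν := by
    intro ν hν; have := hoff ν; rw [if_neg hν] at this; exact_mod_cast this
  unfold bump
  rw [hs, ← hn, ← Finset.mul_prod_erase Finset.univ _ (Finset.mem_univ μ),
    ← Finset.mul_prod_erase Finset.univ (fun ν => bumpN n (offN n x.1 ν)) (Finset.mem_univ μ)]
  have hPeq : ∏ ν ∈ Finset.univ.erase μ, bumpN n (offN n x'.1 ν) = ∏ ν ∈ Finset.univ.erase μ, bumpN n (offN n x.1 ν) :=
    Finset.prod_congr rfl fun ν hν => by rw [hoffν ν (Finset.ne_of_mem_erase hν)]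
  rw [hPeq, ← sub_mul, abs_mul]
  have hP := prod_bumpN_le hn1 (Finset.univ.erase μ) (fun ν => offN n x.1 ν) fun ν => offN_lt hn1 _ _
  rw [Finset.card_erase_of_mem (Finset.mem_univ μ), Finset.card_univ, Fintype.card_fin, Nat.add_sub_cancel] at hP
  rw [abs_of_nonneg hP.1]
  have hlt : offN n x.1 μ + 1 < n := by have := offN_lt hn1 x'.1 μ; omega
  have hstep := abs_bumpN_succ_sub_le hn1 hlt
  rw [← hoffμ] at hstep
  have h6 : (0 : ℝ) ≤ 6 / n := by positivity
  calc |bumpN n (offN n x'.1 μ) - bumpN n (offN n x.1 μ)| * ∏ ν ∈ Finset.univ.erase μ, bumpN n (offN n x.1 ν)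
      ≤ 6 / n * ∏ ν ∈ Finset.univ.erase μ, bumpN n (offN n x.1 ν) := mul_le_mul_of_nonneg_right hstep hP.1
    _ ≤ 6 / n * (3 / 2 : ℝ) ^ d := mul_le_mul_of_nonneg_left hP.2 h6

/-- **the block sum of the bump is `W(y)`**: `Σ_{x∈B^j(y)} b(x) = Π_μ Σ_{r<L^j} β̃(r) = (L^j)^{d+1}`.
[cite: Balaban1984PropagatorsI, p.25; bookkeeping] -/
theorem sum_bump_fiber (s : ↥(bset D)) :
    ∑ x ∈ Finset.univ.filter (fun x => blkOf D x = s), bump D x = W D s := by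
  classical
  rw [sum_fiber_eq_sum_chart]
  have hterm : ∀ t : Fin (d + 1) → Fin (nb D s), bump D (siteOf D s t) = ∏ μ, bumpN (nb D s) (t μ) := by
    intro t
    unfold bump
    rw [blkOf_siteOf]
    refine Finset.prod_congr rfl fun μ _ => ?_
    rw [siteOf_val, offN_finePt (one_le_nb D s)]
  rw [Finset.sum_congr rfl fun t _ => hterm t, ← Fintype.prod_sum fun μ (r : Fin (nb D s)) => bumpN (nb D s) r]
  rw [Finset.prod_const, Finset.card_univ, Fintype.card_fin, Fin.sum_univ_eq_sum_range (fun r => bumpN (nb D s) r),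
    sum_bumpN (one_le_nb D s), W_eq_nb_pow]

/-- **a neighbour in ANOTHER block forces a face**: if `x′ ∼ x` and `y(x′) ≠ y(x)` then `x_μ mod L^j ∈ {0, L^j − 1}` for
the direction `μ` of the bond. [cite: Balaban1984PropagatorsII, (2.1) p.224, dictionary] -/
theorem face_of_nbr {x x' : ↥(boxDom (N0 ℓ Mh k P))} (hnb : x'.1 ∈ nbrs x.1) (hne : blkOf D x' ≠ blkOf D x) :
    ∃ μ, offN (nb D (blkOf D x)) x.1 μ = 0 ∨ offN (nb D (blkOf D x)) x.1 μ + 1 = nb D (blkOf D x) := by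
  set n := nb D (blkOf D x) with hn
  have hn1 : 1 ≤ n := one_le_nb D _
  have hnz : (n : ℤ) ≠ 0 := by exact_mod_cast (by omega : n ≠ 0)
  obtain ⟨μ, hμ⟩ := mem_nbrs.1 hnb
  refine ⟨μ, ?_⟩
  by_contra hcon
  push Not at hcon
  have hlt : offN n x.1 μ < n := offN_lt hn1 _ _
  -- then `x′` has the same grid block as `x`, contradiction
  apply hne
  rw [← blk_eq_iff_blkOf_eq D x x']
  funext ν
  have hxν := coord_eq_blk_add_offN hn1 x.1 ν
  change x'.1 ν / (n : ℤ) = blk n x.1 ν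
  have hblkν : blk n x.1 ν = x.1 ν / (n : ℤ) := rfl
  rcases hμ with hμ | hμ <;> rw [hμ] <;> by_cases hν : ν = μ
  · subst hν
    rw [Pi.add_apply, Pi.single_eq_same, hxν, add_assoc, Int.mul_add_ediv_left _ _ hnz,
      Int.ediv_eq_zero_of_lt (by positivity) (by omega), add_zero]
  · rw [Pi.add_apply, Pi.single_eq_of_ne hν, add_zero, hblkν]
  · subst hν
    have h0 : 1 ≤ offN n x.1 ν := by
      rcases Nat.eq_zero_or_pos (offN n x.1 ν) with h | h
      · exact absurd h hcon.1
      · exact h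
    rw [Pi.sub_apply, Pi.single_eq_same, hxν, add_sub_assoc, Int.mul_add_ediv_left _ _ hnz,
      Int.ediv_eq_zero_of_lt (by omega) (by omega), add_zero]
  · rw [Pi.sub_apply, Pi.single_eq_of_ne hν, sub_zero, hblkν]

variable (ω : ↥(bset D) → ℝ)

/-- **the test field** `v(x) = (L^j)²·ω(y)·b(x)` for `x ∈ B^j(y)`: amplitude `(L^jη)²ω(y)` (the level weight of `G′`),
shaped by the block bump. [cite: Balaban1984PropagatorsII, (2.74)–(2.77) p.236; Balaban1984PropagatorsI, p.25] -/
def testV (x : ↥(boxDom (N0 ℓ Mh k P))) : ℝ :=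
  ((nb D (blkOf D x) : ℕ) : ℝ) ^ 2 * ω (blkOf D x) * bump D x

/-- **the level-weighted norm `S(ω) = Σ_y W(y)(L^j)²ω(y)²`** (= `Σ_j (L^jη)²‖ω_j‖²` in the pairing (2.69)).
[cite: Balaban1984PropagatorsII, (2.69) p.235, (2.77) p.236] -/
def Sw : ℝ := ∑ s, W D s * ((nb D s : ℕ) : ℝ) ^ 2 * ω s ^ 2

/-- `S(ω) ≥ 0`. [cite: Balaban1984PropagatorsII, (2.69) p.235, dictionary] -/
theorem Sw_nonneg : 0 ≤ Sw D ω :=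
  Finset.sum_nonneg fun s _ => mul_nonneg (mul_nonneg (W_pos D s).le (sq_nonneg _)) (sq_nonneg _)

/-- **`⟨v, Q′*ω⟩ = S(ω)`**: the bump has block mean one. [cite: Balaban1984PropagatorsII, (2.74) p.236; Balaban1984PropagatorsI, p.25] -/
theorem testV_dot_QsB : testV D ω ⬝ᵥ QsB D ω = Sw D ω := by
  classical
  unfold dotProduct Sw
  simp only [QsB_apply, testV]
  rw [← Finset.sum_fiberwise Finset.univ (blkOf D)
    (fun x => ((nb D (blkOf D x) : ℕ) : ℝ) ^ 2 * ω (blkOf D x) * bump D x * ω (blkOf D x))]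
  refine Finset.sum_congr rfl fun s _ => ?_
  rw [Finset.sum_congr rfl fun x hx => by rw [(Finset.mem_filter.1 hx).2], show
    ∑ x ∈ Finset.univ.filter (fun x => blkOf D x = s), ((nb D s : ℕ) : ℝ) ^ 2 * ω s * bump D x * ω s
      = ∑ x ∈ Finset.univ.filter (fun x => blkOf D x = s), (((nb D s : ℕ) : ℝ) ^ 2 * ω s * ω s) * bump D x from
    Finset.sum_congr rfl fun x _ => by ring, ← Finset.mul_sum, sum_bump_fiber]
  ring

end Bump

/-! ## §3 The energy `⟨v, Δ′_av⟩` of the test field -/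

section Energy

variable {ℓ Mh k R : ℕ} {P : Fin (d + 1) → ℕ} (D : Domains d ℓ Mh k P R)

/-- `c₁ > 0`. [folklore] -/
private theorem c1_pos (d : ℕ) : 0 < c1 d := by unfold c1; positivity

variable (ω : ↥(bset D) → ℝ)

/-- the block weight `φ(x) = (L^j)²ω(y)²`, `x ∈ B^j(y)`. [cite: Balaban1984PropagatorsII, (2.77) p.236; bookkeeping] -/
def phi (x : ↥(boxDom (N0 ℓ Mh k P))) : ℝ := ((nb D (blkOf D x) : ℕ) : ℝ) ^ 2 * ω (blkOf D x) ^ 2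

/-- `φ ≥ 0`. [folklore] -/
private theorem phi_nonneg (x : ↥(boxDom (N0 ℓ Mh k P))) : 0 ≤ phi D ω x := by unfold phi; positivity

/-- `Σ_x φ(x) = S(ω)`. [cite: Balaban1984PropagatorsII, (2.69) p.235; bookkeeping] -/
theorem sum_phi : ∑ x, phi D ω x = Sw D ω := by
  unfold phi Sw
  rw [sum_blockFun D fun s => ((nb D s : ℕ) : ℝ) ^ 2 * ω s ^ 2]
  exact Finset.sum_congr rfl fun s _ => by ring

/-- the face bound: if `x` lies on a face of its block then `v(x)² ≤ 36(9/4)^d·φ(x)`. [cite: Balaban1984PropagatorsI, p.25; bookkeeping] -/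
theorem testV_sq_le_of_face (x : ↥(boxDom (N0 ℓ Mh k P))) (μ : Fin (d + 1))
    (h : offN (nb D (blkOf D x)) x.1 μ = 0 ∨ offN (nb D (blkOf D x)) x.1 μ + 1 = nb D (blkOf D x)) :
    testV D ω x ^ 2 ≤ 36 * (9 / 4 : ℝ) ^ d * phi D ω x := by
  have hb := bump_face_le D x μ h
  have hb0 := bump_nonneg D x
  set n : ℝ := ((nb D (blkOf D x) : ℕ) : ℝ) with hn
  have hn1 : (1 : ℝ) ≤ n := by rw [hn]; exact_mod_cast one_le_nb D _
  have hsq : bump D x ^ 2 ≤ (6 / n * (3 / 2 : ℝ) ^ d) ^ 2 := pow_le_pow_left₀ hb0 hb 2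
  unfold testV phi
  rw [← hn]
  have h94 : ((3 / 2 : ℝ) ^ d) ^ 2 = (9 / 4 : ℝ) ^ d := by rw [← pow_mul, mul_comm, pow_mul]; norm_num
  calc (n ^ 2 * ω (blkOf D x) * bump D x) ^ 2 = n ^ 4 * ω (blkOf D x) ^ 2 * bump D x ^ 2 := by ring
    _ ≤ n ^ 4 * ω (blkOf D x) ^ 2 * (6 / n * (3 / 2 : ℝ) ^ d) ^ 2 :=
        mul_le_mul_of_nonneg_left hsq (by positivity)
    _ = 36 * ((3 / 2 : ℝ) ^ d) ^ 2 * (n ^ 2 * ω (blkOf D x) ^ 2) := by field_simp; ring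
    _ = 36 * (9 / 4 : ℝ) ^ d * (n ^ 2 * ω (blkOf D x) ^ 2) := by rw [h94]

/-- the interior bound: for `x′ = x + e_μ` in the block of `x`, `(v(x′) − v(x))² ≤ 36(9/4)^d·φ(x)`.
[cite: Balaban1984PropagatorsI, p.25; bookkeeping] -/
theorem testV_sub_sq_le_of_same {x x' : ↥(boxDom (N0 ℓ Mh k P))} (hs : blkOf D x' = blkOf D x) {μ : Fin (d + 1)}
    (hx' : x'.1 = x.1 + Pi.single μ 1) :
    (testV D ω x' - testV D ω x) ^ 2 ≤ 36 * (9 / 4 : ℝ) ^ d * phi D ω x := by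
  have hb := abs_bump_sub_le D hs hx'
  set n : ℝ := ((nb D (blkOf D x) : ℕ) : ℝ) with hn
  unfold testV phi
  rw [hs, ← hn]
  have hsq : (bump D x' - bump D x) ^ 2 ≤ (6 / n * (3 / 2 : ℝ) ^ d) ^ 2 := by
    rw [← sq_abs]; exact pow_le_pow_left₀ (abs_nonneg _) hb 2
  have hn1 : (1 : ℝ) ≤ n := by rw [hn]; exact_mod_cast one_le_nb D _
  have h94 : ((3 / 2 : ℝ) ^ d) ^ 2 = (9 / 4 : ℝ) ^ d := by rw [← pow_mul, mul_comm, pow_mul]; norm_num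
  calc (n ^ 2 * ω (blkOf D x) * bump D x' - n ^ 2 * ω (blkOf D x) * bump D x) ^ 2
      = n ^ 4 * ω (blkOf D x) ^ 2 * (bump D x' - bump D x) ^ 2 := by ring
    _ ≤ n ^ 4 * ω (blkOf D x) ^ 2 * (6 / n * (3 / 2 : ℝ) ^ d) ^ 2 := mul_le_mul_of_nonneg_left hsq (by positivity)
    _ = 36 * ((3 / 2 : ℝ) ^ d) ^ 2 * (n ^ 2 * ω (blkOf D x) ^ 2) := by field_simp; ring
    _ = 36 * (9 / 4 : ℝ) ^ d * (n ^ 2 * ω (blkOf D x) ^ 2) := by rw [h94]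

/-- **the bond bound**: for neighbours `x ∼ x′`, `(v(x) − v(x′))² ≤ c₁·(φ(x) + φ(x′))` — inside a block by the Lipschitz
bound of the bump, across a block face by its smallness there. [cite: Balaban1984PropagatorsI, p.25; bookkeeping] -/
theorem bond_sq_le {x x' : ↥(boxDom (N0 ℓ Mh k P))} (hnb : x'.1 ∈ nbrs x.1) :
    (testV D ω x - testV D ω x') ^ 2 ≤ c1 d * (phi D ω x + phi D ω x') := by
  have hφ := phi_nonneg D ω x
  have hφ' := phi_nonneg D ω x'
  have h94 : (0 : ℝ) ≤ (9 / 4 : ℝ) ^ d := by positivity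
  unfold c1
  by_cases hs : blkOf D x' = blkOf D x
  · -- same block: `x′ = x ± e_μ`
    obtain ⟨μ, hμ | hμ⟩ := mem_nbrs.1 hnb
    · have h := testV_sub_sq_le_of_same D ω hs hμ
      rw [← neg_sub, neg_sq] at h
      nlinarith
    · have hx : x.1 = x'.1 + Pi.single μ 1 := by rw [hμ]; abel
      have h := testV_sub_sq_le_of_same D ω hs.symm hx
      nlinarith
  · -- different blocks: both end points lie on faces of their blocks
    obtain ⟨μ, hμ⟩ := face_of_nbr D hnb hs
    obtain ⟨μ', hμ'⟩ := face_of_nbr D (B4Reflection242.nbrs_comm.1 hnb) (Ne.symm hs)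
    have h1 := testV_sq_le_of_face D ω x μ hμ
    have h2 := testV_sq_le_of_face D ω x' μ' hμ'
    nlinarith [sq_nonneg (testV D ω x + testV D ω x')]

/-- every box point has at most `2(d+1)` box neighbours. [folklore] -/
private theorem card_boxNbrs_le (x : ↥(boxDom (N0 ℓ Mh k P))) : ((boxNbrs (N0 ℓ Mh k P) x).card : ℝ) ≤ 2 * ((d : ℝ) + 1) := by
  have h : (boxNbrs (N0 ℓ Mh k P) x).card ≤ 2 * (d + 1) := by
    rw [card_boxNbrs, ← card_nbrs x.1]
    exact Finset.card_filter_le _ _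
  exact_mod_cast h

/-- **the bond form of the test field is `O(S(ω))`**: `½Σ_xΣ_{x′∼x}(v(x) − v(x′))² ≤ 2(d+1)c₁·S(ω)`.
[cite: Balaban1984PropagatorsII, (2.74)–(2.77) p.236; Balaban1984PropagatorsI, p.25] -/
theorem lapForm_le :
    1 / 2 * ∑ x, ∑ x' ∈ boxNbrs (N0 ℓ Mh k P) x, (testV D ω x - testV D ω x') ^ 2
      ≤ 2 * ((d : ℝ) + 1) * c1 d * Sw D ω := by
  have hφ := phi_nonneg D ω
  have hc1 := (c1_pos d).le
  -- termwise bound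
  have h1 : ∑ x, ∑ x' ∈ boxNbrs (N0 ℓ Mh k P) x, (testV D ω x - testV D ω x') ^ 2
      ≤ ∑ x, ∑ x' ∈ boxNbrs (N0 ℓ Mh k P) x, c1 d * (phi D ω x + phi D ω x') :=
    Finset.sum_le_sum fun x _ => Finset.sum_le_sum fun x' hx' =>
      bond_sq_le D ω (by unfold boxNbrs at hx'; exact (Finset.mem_filter.1 hx').2)
  -- the double sum of `φ(x′)` is the double sum of `φ(x)` (the neighbour relation is symmetric)
  have hswap : ∑ x, ∑ x' ∈ boxNbrs (N0 ℓ Mh k P) x, phi D ω x'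
      = ∑ x', ∑ _x ∈ boxNbrs (N0 ℓ Mh k P) x', phi D ω x' := by
    refine Finset.sum_comm' ?_
    intro x x'
    simp only [Finset.mem_univ, true_and, and_true]
    exact mem_boxNbrs_comm
  have h2 : ∑ x, ∑ x' ∈ boxNbrs (N0 ℓ Mh k P) x, c1 d * (phi D ω x + phi D ω x')
      = c1 d * (∑ x, ((boxNbrs (N0 ℓ Mh k P) x).card : ℝ) * phi D ω x
          + ∑ x', ((boxNbrs (N0 ℓ Mh k P) x').card : ℝ) * phi D ω x') := by
    simp only [mul_add, Finset.sum_add_distrib, ← Finset.mul_sum]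
    rw [hswap]
    simp only [Finset.sum_const, nsmul_eq_mul]
  have h3 : ∑ x, ((boxNbrs (N0 ℓ Mh k P) x).card : ℝ) * phi D ω x ≤ 2 * ((d : ℝ) + 1) * Sw D ω := by
    rw [← sum_phi, Finset.mul_sum]
    exact Finset.sum_le_sum fun x _ => mul_le_mul_of_nonneg_right (card_boxNbrs_le x) (hφ x)
  have hS := Sw_nonneg D ω
  nlinarith [h1, h2, h3]

variable (a : ℕ → ℝ)

/-- the block sum of the test field: `Σ_{x∈B^j(y)} v(x) = (L^j)²ω(y)W(y)`. [cite: Balaban1984PropagatorsII, (2.74) p.236; bookkeeping] -/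
theorem sum_testV_fiber (s : ↥(bset D)) :
    ∑ x ∈ Finset.univ.filter (fun x => blkOf D x = s), testV D ω x = ((nb D s : ℕ) : ℝ) ^ 2 * ω s * W D s := by
  unfold testV
  rw [Finset.sum_congr rfl fun x hx => by rw [(Finset.mem_filter.1 hx).2], ← Finset.mul_sum, sum_bump_fiber]

/-- **the averaging form of the test field, exactly**: `Σ_x v(x)·levC_{j(x)}·Σ_{x′∈B(y(x))}v(x′) = Σ_y a_j·W(y)(L^j)²ω(y)²`
(`levC_j = a_j(L^j)^{−2}(L^{j(d+1)})^{−1}`, block sums `(L^j)²ω(y)W(y)`). [cite: Balaban1984PropagatorsII, (2.14) p.225, (2.74) p.236] -/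
theorem avgForm_eq :
    ∑ x, testV D ω x * (levC d ℓ a (D.lev x.1) * ∑ x' ∈ Finset.univ.filter (fun x' => blkOf D x' = blkOf D x), testV D ω x')
      = ∑ s, a s.1.1 * (W D s * ((nb D s : ℕ) : ℝ) ^ 2 * ω s ^ 2) := by
  classical
  have hlev : ∀ x : ↥(boxDom (N0 ℓ Mh k P)), D.lev x.1 = (blkOf D x).1.1 := fun x => rfl
  simp only [hlev, sum_testV_fiber]
  -- `Σ_x (levC·n²ωW)(y(x))·v(x)` fibrewise
  have hterm : ∀ x : ↥(boxDom (N0 ℓ Mh k P)), testV D ω x * (levC d ℓ a (blkOf D x).1.1 *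
      (((nb D (blkOf D x) : ℕ) : ℝ) ^ 2 * ω (blkOf D x) * W D (blkOf D x)))
      = (levC d ℓ a (blkOf D x).1.1 * ((nb D (blkOf D x) : ℕ) : ℝ) ^ 4 * ω (blkOf D x) ^ 2 * W D (blkOf D x))
        * bump D x := by
    intro x; unfold testV; ring
  rw [Finset.sum_congr rfl fun x _ => hterm x,
    ← Finset.sum_fiberwise Finset.univ (blkOf D) fun x =>
      (levC d ℓ a (blkOf D x).1.1 * ((nb D (blkOf D x) : ℕ) : ℝ) ^ 4 * ω (blkOf D x) ^ 2 * W D (blkOf D x)) * bump D x]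
  refine Finset.sum_congr rfl fun s _ => ?_
  rw [Finset.sum_congr rfl fun x hx => by rw [(Finset.mem_filter.1 hx).2], ← Finset.mul_sum, sum_bump_fiber]
  -- the constants: `levC_j·n⁴·W² = a_j·W·n²`
  have hn : (0 : ℝ) < ((nb D s : ℕ) : ℝ) := by exact_mod_cast one_le_nb D s
  have hL : (((ℓ : ℝ) + 1) ^ s.1.1) = ((nb D s : ℕ) : ℝ) := by unfold nb; push_cast; ring
  unfold levC
  rw [hL, W_eq_nb_pow]
  field_simp

/-- **the form identity**: `⟨v, Δ′_av⟩ = ½Σ_xΣ_{x′∼x}(v(x) − v(x′))² + Σ_x v(x)·levC_{j(x)}·Σ_{x′∈B(y(x))}v(x′)` for every `v`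
(entries of `Δ′_a` = `mlOp_apply`; the Laplacian form = `quadFormR_eq`). [cite: Balaban1984PropagatorsII, (2.13)–(2.14) p.225] -/
theorem form_eq (v : ↥(boxDom (N0 ℓ Mh k P)) → ℝ) :
    v ⬝ᵥ (mlOp (N0 ℓ Mh k P) ℓ k D.lev a *ᵥ v)
      = 1 / 2 * (∑ x, ∑ x' ∈ boxNbrs (N0 ℓ Mh k P) x, (v x - v x') ^ 2)
        + ∑ x, v x * (levC d ℓ a (D.lev x.1) * ∑ x' ∈ Finset.univ.filter (fun x' => B6Geom246MultiLevelBoxL0.blkOf D x' = blkOf D x), v x') := by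
  classical
  -- split the entries
  have hsplit : v ⬝ᵥ (mlOp (N0 ℓ Mh k P) ℓ k D.lev a *ᵥ v)
      = v ⬝ᵥ (opBoxR 1 0 0 1 (N0 ℓ Mh k P) *ᵥ v)
        + ∑ x, v x * ∑ x', avgK (levC d ℓ a (D.lev x.1)) ((ℓ + 1) ^ D.lev x.1) x.1 x'.1 * v x' := by
    have hrow : ∀ x, (mlOp (N0 ℓ Mh k P) ℓ k D.lev a *ᵥ v) x
        = (opBoxR 1 0 0 1 (N0 ℓ Mh k P) *ᵥ v) x
          + ∑ x', avgK (levC d ℓ a (D.lev x.1)) ((ℓ + 1) ^ D.lev x.1) x.1 x'.1 * v x' := by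
      intro x
      change ∑ x', mlOp (N0 ℓ Mh k P) ℓ k D.lev a x x' * v x' = (∑ x', opBoxR 1 0 0 1 (N0 ℓ Mh k P) x x' * v x') + _
      rw [← Finset.sum_add_distrib]
      refine Finset.sum_congr rfl fun x' _ => ?_
      rw [mlOp_apply D rfl a x x']
      simp [opBoxR, diagK, avgK, add_mul]
    unfold dotProduct
    simp only [hrow, mul_add, Finset.sum_add_distrib]
  rw [hsplit, quadFormR_eq]
  simp only [zero_mul, add_zero, one_div]
  congr 1
  refine Finset.sum_congr rfl fun x _ => ?_
  congr 1
  -- the averaging kernel row: `Σ_{x′} levC·[x′ ∼_j x]·v(x′) = levC·Σ_{x′∈B(y(x))} v(x′)`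
  have hb : ∀ x' : ↥(boxDom (N0 ℓ Mh k P)), avgK (levC d ℓ a (D.lev x.1)) ((ℓ + 1) ^ D.lev x.1) x.1 x'.1 * v x'
      = if blkOf D x' = blkOf D x then levC d ℓ a (D.lev x.1) * v x' else 0 := by
    intro x'
    have hiff : blk ((ℓ + 1) ^ D.lev x.1) x'.1 = blk ((ℓ + 1) ^ D.lev x.1) x.1 ↔ blkOf D x' = blkOf D x :=
      blk_eq_iff_blkOf_eq D x x'
    unfold avgK
    by_cases h : blkOf D x' = blkOf D x
    · rw [if_pos (hiff.2 h), if_pos h]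
    · rw [if_neg (fun hh => h (hiff.1 hh)), if_neg h, zero_mul]
  rw [Finset.sum_congr rfl fun x' _ => hb x', ← Finset.sum_filter, Finset.mul_sum]

/-- **THE ENERGY BOUND**: `⟨v, Δ′_av⟩ ≤ C_E·S(ω)` for weights `0 < a_j ≤ a₊` (`j ≥ 1`).
[cite: Balaban1984PropagatorsII, (2.74)–(2.77) p.236; Balaban1984PropagatorsI, p.25 (positivity of Q′G′Q′*)] -/
theorem energy_le {aplus : ℝ} (hale : ∀ j, a j ≤ aplus) :
    testV D ω ⬝ᵥ (mlOp (N0 ℓ Mh k P) ℓ k D.lev a *ᵥ testV D ω) ≤ CE d aplus * Sw D ω := by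
  rw [form_eq, avgForm_eq]
  have h1 := lapForm_le D ω
  have h2 : ∑ s : ↥(bset D), a s.1.1 * (W D s * ((nb D s : ℕ) : ℝ) ^ 2 * ω s ^ 2) ≤ aplus * Sw D ω := by
    unfold Sw
    rw [Finset.mul_sum]
    refine Finset.sum_le_sum fun s _ => mul_le_mul_of_nonneg_right (hale _) ?_
    exact mul_nonneg (mul_nonneg (W_pos D s).le (sq_nonneg _)) (sq_nonneg _)
  unfold CE
  linarith

end Energy

/-! ## §4 (2.74)–(2.78): level-weighted coercivity of `Q′G′Q′*` and `Q′G′²Q′*` -/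

section Coercive

variable {ℓ Mh k R : ℕ} {P : Fin (d + 1) → ℕ} (D : Domains d ℓ Mh k P R)

/-- **[B6] (2.74)–(2.77) FOR THE GENUINE `k`-LEVEL OPERATOR, LEVEL-WEIGHTED**: for every nested family on the box and
every weight sequence `0 < a_j ≤ a₊` (`j ≥ 0`: LEVEL-0 TWIN, the level-`0` weight is genuine), `⟨Q′*ω, G′Q′*ω⟩ ≥ C_E⁻¹·Σ_y W(y)(L^j)²ω(y)²` — «Q′_jG′_jQ′_j* ≥ 2γ₀ …
where γ₀ is an absolute constant», here uniformly in `k`, `M_h`, `R`, `P` and the family, with the level weight `(L^jη)²`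
of `G′` made explicit (print's rescaling to the unit lattice of level `j`). Variational route: `⟨u, Δ′_a⁻¹u⟩ ≥ 2⟨A, u⟩ −
⟨A, Δ′_aA⟩` with `A = v/C_E`. [cite: Balaban1984PropagatorsII, (2.74)–(2.77) p.236; Balaban1984PropagatorsI, p.25] -/
theorem qgq_coercive_multiLevelBox (hMh : 1 ≤ Mh) (hP : ∀ μ, 1 ≤ P μ) {a : ℕ → ℝ} {aplus : ℝ}
    (ha : ∀ j, 0 < a j) (hale : ∀ j, a j ≤ aplus) (ω : ↥(bset D) → ℝ) :
    (CE d aplus)⁻¹ * Sw D ω ≤ QsB D ω ⬝ᵥ (gml (N0 ℓ Mh k P) ℓ k D.lev a *ᵥ QsB D ω) := by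
  have haplus : 0 ≤ aplus := (ha 0).le.trans (hale 0)
  have hCE := CE_pos d haplus
  set c : ℝ := (CE d aplus)⁻¹ with hc
  have hc0 : 0 < c := inv_pos.2 hCE
  -- LEVEL-0 TWIN: the level-`0` weight is a genuine weight (`Q′₀ = id`, finite `a₀`), positive by hypothesis — no `mlOp_congr_weights`
  have hunit : IsUnit (mlOp (N0 ℓ Mh k P) ℓ k D.lev a) := mlOp_isUnit (one_le_N0 hMh hP) D.lev_le ha
  have hsymm := mlOp_isSymm (N := N0 ℓ Mh k P) ℓ k D.lev a
  have hpos : ∀ v, 0 ≤ v ⬝ᵥ (mlOp (N0 ℓ Mh k P) ℓ k D.lev a *ᵥ v) := fun v => mlOp_form_nonneg ha v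
  have key := two_dot_sub_form_le_inv_form (mlOp (N0 ℓ Mh k P) ℓ k D.lev a) hsymm hunit hpos
    (c • testV D ω) (QsB D ω)
  have hE := energy_le D ω a hale
  have hS := Sw_nonneg D ω
  have e1 : (c • testV D ω) ⬝ᵥ QsB D ω = c * Sw D ω := by rw [smul_dotProduct, testV_dot_QsB, smul_eq_mul]
  have e2 : (c • testV D ω) ⬝ᵥ (mlOp (N0 ℓ Mh k P) ℓ k D.lev a *ᵥ (c • testV D ω))
      = c ^ 2 * (testV D ω ⬝ᵥ (mlOp (N0 ℓ Mh k P) ℓ k D.lev a *ᵥ testV D ω)) := by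
    rw [Matrix.mulVec_smul, dotProduct_smul, smul_dotProduct, smul_eq_mul, smul_eq_mul]; ring
  rw [e1, e2] at key
  have hcE : c ^ 2 * (testV D ω ⬝ᵥ (mlOp (N0 ℓ Mh k P) ℓ k D.lev a *ᵥ testV D ω)) ≤ c * Sw D ω := by
    calc c ^ 2 * (testV D ω ⬝ᵥ (mlOp (N0 ℓ Mh k P) ℓ k D.lev a *ᵥ testV D ω)) ≤ c ^ 2 * (CE d aplus * Sw D ω) :=
          mul_le_mul_of_nonneg_left hE (by positivity)
      _ = c * Sw D ω := by rw [hc]; field_simp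
  change 2 * (c * Sw D ω) - _ ≤ QsB D ω ⬝ᵥ (gml (N0 ℓ Mh k P) ℓ k D.lev a *ᵥ QsB D ω) at key
  linarith

/-- **(2.78), FIRST FORM** (Cauchy–Schwarz on (2.74)–(2.77)): `‖G′Q′*ω‖²·Σ_yW(y)ω(y)² ≥ (C_E⁻¹S(ω))²` — with
`⟨ω, Q′G′²Q′*ω⟩ = ‖G′Q′*ω‖²` ((2.72)) and `Σ_yWω² = ‖ω‖²` in the pairing (2.69). [cite: Balaban1984PropagatorsII, (2.72)–(2.73), (2.78) p.236] -/
theorem qggq_lower_multiLevelBox (hMh : 1 ≤ Mh) (hP : ∀ μ, 1 ≤ P μ) {a : ℕ → ℝ} {aplus : ℝ}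
    (ha : ∀ j, 0 < a j) (hale : ∀ j, a j ≤ aplus) (ω : ↥(bset D) → ℝ) :
    ((CE d aplus)⁻¹ * Sw D ω) ^ 2 ≤ (∑ s, W D s * ω s ^ 2) *
      ((gml (N0 ℓ Mh k P) ℓ k D.lev a *ᵥ QsB D ω) ⬝ᵥ (gml (N0 ℓ Mh k P) ℓ k D.lev a *ᵥ QsB D ω)) := by
  have h1 := qgq_coercive_multiLevelBox D hMh hP ha hale ω
  have haplus : 0 ≤ aplus := (ha 1).le.trans (hale 1)
  have h0 : 0 ≤ (CE d aplus)⁻¹ * Sw D ω := mul_nonneg (inv_pos.2 (CE_pos d haplus)).le (Sw_nonneg D ω)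
  set u := QsB D ω
  set g := gml (N0 ℓ Mh k P) ℓ k D.lev a *ᵥ u
  have hcs : (u ⬝ᵥ g) ^ 2 ≤ (∑ x, u x ^ 2) * ∑ x, g x ^ 2 := Finset.sum_mul_sq_le_sq_mul_sq _ _ _
  have hu : ∑ x, u x ^ 2 = ∑ s, W D s * ω s ^ 2 := by
    rw [← QsB_dot_QsB]; unfold dotProduct; exact Finset.sum_congr rfl fun x _ => sq (u x)
  have hg : ∑ x, g x ^ 2 = g ⬝ᵥ g := by unfold dotProduct; exact Finset.sum_congr rfl fun x _ => sq (g x)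
  rw [hu, hg] at hcs
  exact (pow_le_pow_left₀ h0 h1 2).trans hcs

/-- **[B6] (2.78) FOR THE GENUINE `k`-LEVEL OPERATOR ON A TWO-LEVEL WINDOW**: for `ω` carried by the blocks of two
adjacent levels `j₀, j₀ + 1` («either □̃ ⊂ B^j(Λ_j), or it intersects B^{j+1}(Λ_{j+1}) also»),
`⟨ω, Q′G′²Q′*ω⟩ = ‖G′Q′*ω‖² ≥ (C_E⁻²/L²)·Σ_y W(y)(L^j)⁴ω(y)²` — print's «⟨ω, (Q′G′²Q′*)ω⟩ ≥ γ₀²‖ω‖²» on the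
`ξ = L^{−j}` lattice, in `η`-units, uniformly in `k` and the family. [cite: Balaban1984PropagatorsII, (2.78) p.236, (2.70)–(2.71) p.235] -/
theorem qggq_coercive_window (hMh : 1 ≤ Mh) (hP : ∀ μ, 1 ≤ P μ) {a : ℕ → ℝ} {aplus : ℝ}
    (ha : ∀ j, 0 < a j) (hale : ∀ j, a j ≤ aplus) (ω : ↥(bset D) → ℝ) (j₀ : ℕ)
    (hω : ∀ s, ω s ≠ 0 → j₀ ≤ s.1.1 ∧ s.1.1 ≤ j₀ + 1) :
    (CE d aplus)⁻¹ ^ 2 / ((ℓ : ℝ) + 1) ^ 2 * ∑ s, W D s * ((nb D s : ℕ) : ℝ) ^ 4 * ω s ^ 2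
      ≤ (gml (N0 ℓ Mh k P) ℓ k D.lev a *ᵥ QsB D ω) ⬝ᵥ (gml (N0 ℓ Mh k P) ℓ k D.lev a *ᵥ QsB D ω) := by
  have hlow := qggq_lower_multiLevelBox D hMh hP ha hale ω
  have hL0 : (0 : ℝ) < (ℓ : ℝ) + 1 := by positivity
  have hL1 : (1 : ℝ) ≤ (ℓ : ℝ) + 1 := by linarith [(Nat.cast_nonneg ℓ : (0 : ℝ) ≤ ℓ)]
  set c : ℝ := (CE d aplus)⁻¹ with hc
  set l : ℝ := ((ℓ : ℝ) + 1) ^ j₀ with hl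
  set N₂ : ℝ := ∑ s, W D s * ω s ^ 2 with hN₂
  set S : ℝ := Sw D ω with hSdef
  set T : ℝ := ∑ s, W D s * ((nb D s : ℕ) : ℝ) ^ 4 * ω s ^ 2 with hT
  set G : ℝ := (gml (N0 ℓ Mh k P) ℓ k D.lev a *ᵥ QsB D ω) ⬝ᵥ (gml (N0 ℓ Mh k P) ℓ k D.lev a *ᵥ QsB D ω) with hG
  have hS0 : 0 ≤ S := Sw_nonneg D ω
  have hG0 : 0 ≤ G := by
    rw [hG]; unfold dotProduct; exact Finset.sum_nonneg fun x _ => mul_self_nonneg _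
  -- on the window: `l ≤ n(y) ≤ L·l` wherever `ω ≠ 0`
  have hnb : ∀ s : ↥(bset D), ω s ≠ 0 → l ≤ ((nb D s : ℕ) : ℝ) ∧ ((nb D s : ℕ) : ℝ) ≤ ((ℓ : ℝ) + 1) * l := by
    intro s hs
    obtain ⟨h1, h2⟩ := hω s hs
    unfold nb; push_cast
    refine ⟨pow_le_pow_right₀ hL1 h1, ?_⟩
    rw [hl, ← pow_succ']
    exact pow_le_pow_right₀ hL1 h2
  -- termwise comparisons
  have hSN : l ^ 2 * N₂ ≤ S := by
    rw [hN₂, hSdef, Sw, Finset.mul_sum]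
    refine Finset.sum_le_sum fun s _ => ?_
    by_cases hs : ω s = 0
    · simp [hs]
    · have h := (hnb s hs).1
      have hl0 : 0 ≤ l := by positivity
      have hW := (W_pos D s).le
      have : l ^ 2 ≤ ((nb D s : ℕ) : ℝ) ^ 2 := pow_le_pow_left₀ hl0 h 2
      nlinarith [sq_nonneg (ω s), mul_nonneg hW (sq_nonneg (ω s))]
  have hTS : T ≤ ((ℓ : ℝ) + 1) ^ 2 * l ^ 2 * S := by
    rw [hT, hSdef, Sw, Finset.mul_sum]
    refine Finset.sum_le_sum fun s _ => ?_
    by_cases hs : ω s = 0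
    · simp [hs]
    · have h := (hnb s hs).2
      have hn0 : 0 ≤ ((nb D s : ℕ) : ℝ) := by positivity
      have hW := (W_pos D s).le
      have h2 : ((nb D s : ℕ) : ℝ) ^ 2 ≤ (((ℓ : ℝ) + 1) * l) ^ 2 := pow_le_pow_left₀ hn0 h 2
      have h4 : ((nb D s : ℕ) : ℝ) ^ 4 ≤ (((ℓ : ℝ) + 1) * l) ^ 2 * ((nb D s : ℕ) : ℝ) ^ 2 := by
        nlinarith [sq_nonneg (((nb D s : ℕ) : ℝ))]
      nlinarith [mul_nonneg hW (sq_nonneg (ω s))]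
  -- `(cS)² ≤ N₂·G` and the two comparisons
  by_cases hN0 : N₂ = 0
  · -- then `ω = 0` on every block (`W > 0`), so `T = 0`
    have hz : ∀ s : ↥(bset D), ω s = 0 := by
      intro s
      have hterm := (Finset.sum_eq_zero_iff_of_nonneg fun s _ => mul_nonneg (W_pos D s).le (sq_nonneg (ω s))).1
        hN0 s (Finset.mem_univ s)
      rcases mul_eq_zero.1 hterm with h | h
      · exact absurd h (W_pos D s).ne'
      · exact pow_eq_zero_iff two_ne_zero |>.1 h
    have hT0 : T = 0 := by rw [hT]; exact Finset.sum_eq_zero fun s _ => by simp [hz s]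
    rw [hT0, mul_zero]; exact hG0
  · have hNpos : 0 < N₂ := lt_of_le_of_ne (Finset.sum_nonneg fun s _ => mul_nonneg (W_pos D s).le (sq_nonneg _))
      (Ne.symm hN0)
    -- `G ≥ c²S²/N₂ ≥ c²·l²·S ≥ c²·T/L²`
    have h1 : c ^ 2 * S ^ 2 ≤ N₂ * G := by rw [← mul_pow]; exact hlow
    have h2 : c ^ 2 * l ^ 2 * S * N₂ ≤ c ^ 2 * S ^ 2 := by
      have : c ^ 2 * S * (l ^ 2 * N₂) ≤ c ^ 2 * S * S :=
        mul_le_mul_of_nonneg_left hSN (mul_nonneg (sq_nonneg c) hS0)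
      nlinarith [this]
    have h3 : c ^ 2 * l ^ 2 * S ≤ G := by
      by_contra hcon
      push Not at hcon
      have : N₂ * G < N₂ * (c ^ 2 * l ^ 2 * S) := mul_lt_mul_of_pos_left hcon hNpos
      nlinarith [this, h1, h2]
    have hL2 : (0 : ℝ) < ((ℓ : ℝ) + 1) ^ 2 := by positivity
    rw [div_mul_eq_mul_div, div_le_iff₀ hL2]
    nlinarith [mul_le_mul_of_nonneg_left hTS (sq_nonneg c), mul_le_mul_of_nonneg_left h3 hL2.le]

end Coercive

end

end Literature.MathematicalPhysics.QuantumFieldTheory.Balaban1983to89.B6QGQCoerciveMultiLevelBoxL0
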